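import Literature.RepresentationTheory.Kovacevic2021.SU21PrincipalSeriesReducibility
import HarnessLib

/-!
# The lattice of Lie submodules of Kovačević's `V(c, 2t)`: lower sets of the cone closed across the live arrows

Continuation of `…Kovacevic2021.SU21SubmoduleLattice` (a Lie submodule `N` of the `𝔤𝔩(3,ℂ)`-module of a datum
is determined, monotonically, by the set of `K`-types it meets, and these sets are exactly the arrow-closed ones)
and `…Kovacevic2021.SU21PrincipalSeriesReducibility` (the live arrows of `V(c,2t)` in the cone coordinates
`(p,q) ↦ V_{1+p+q, 2t+3p−3q}`: `A : (p,q) → (p+1,q)` live iff `a(p) = 2c−(p+1)t−p(p+2) ≠ 0`,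
`B : (p,q) → (p,q+1)` live iff `b(q) = 2c+(q+1)t−q(q+2) ≠ 0`, the down-arrows `C`, `D` always live).

Source, verbatim [Kovacevic2021, §3 Remark 6, held text `paper:arxiv-1810.01752` p0008]: "Reducibility of modules
`V(c,2t)` will be obtained when some product(s) `a_{nm} d_{n+1,m+3}` or `b_{nm} c_{n+1,m-3}` are equal to `0`.
Now, it is not complicated to analyze all cases. Furthermore, it will be possible to determine if we have a
submodule, quotient or subquotient."  This file carries out that analysis for EVERY `(c, t)` at the level of the
whole submodule lattice:

* §1 **membership is constant on root-free cells** (`principalSeries_vec_one_mem_iff_of_noRoot_p/q`): if `a` has no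
  root in `[p, p')` then `u^1_{(p,q)} ∈ N ↔ u^1_{(p',q)} ∈ N`, and likewise in `q`;
* §2 **the `K`-type set of a submodule is a lower set of `ℕ × ℕ`** (`principalSeries_vec_one_mem_of_le`,
  `principalSeries_isLowerSet`) closed one step to the right across every non-root of `a` and one step up across
  every non-root of `b`; and `N ≤ N'` iff the `K`-type sets are nested (`principalSeries_le_iff_forall_nat`);
* §3 **conversely** every lower set `R ⊆ ℕ × ℕ` with these two closure properties is the `K`-type set of EXACTLY ONE
  Lie submodule (`principalSeries_existsUnique_lieSubmodule`) — so the submodule lattice of `V(c,2t)` is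
  order-isomorphic to the lattice of such sets `R` (equivalently: lower sets in the finite grid of root-free cells);
* §4 **finiteness**: `a` and `b` have finitely many roots in `ℕ` (`acoef_natRoots_finite`, `bcoef_natRoots_finite`;
  they are values of a monic-up-to-sign quadratic polynomial), hence a submodule is determined by the `K`-types
  `(p,q)` with `p, q ≤ B` that it meets, for a root-free bound `B` (`principalSeries_exists_rootFree_bound`), and
  **`V(c,2t)` has only finitely many Lie submodules** (`principalSeries_lieSubmodule_finite`) — in particular it has
  finite length.

The cohomological points `(c,t) = (0,0), (−3/2, ±3)` (one root of `a` and/or `b` in `ℕ`, lattices with 6 resp. 4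
elements, composition series `SU21PrincipalSeriesCompositionFactors` / `SU21HolomorphicCompositionFactors`) are the
instances used by [BorelWallach2000, VI 4.10 (10)].  Theorems only; no definitions, no named facts.

## References

* D. Kovačević, *Unitary `(𝔤,K)` modules of `SU(2,1)`*, Acta Math. Spalatensia 1 (2021) 105–125
  (arXiv:1810.01752): §3 Thm 3 with its proof, Remark 2, Remark 6. [Kovacevic2021]
* A. Borel, N. Wallach (2000), VI 4.10 (10) p. 132. [BorelWallach2000]
-/

namespace Literature.RepresentationTheory.Kovacevic2021

-- Mathlib idiom (Mathlib/Algebra/Lie/OfAssociative.lean): commutator brackets on associative algebras; needed for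
-- the `𝔤𝔩(3,ℂ)`-module structure on `𝒟.V`, as in every file of this directory.
attribute [local instance 100] LieRing.ofAssociativeRing

namespace SU21Datum

open PrincipalSeries

section Cells

variable {c : ℂ} {t : ℤ} (N : LieSubmodule ℂ (Matrix (Fin 3) (Fin 3) ℂ) (principalSeries c t).V)

/-! ## §1 Membership is constant on root-free cells -/

/-- **No root of `a` in `[p, p')` ⇒ `u^1_{(p,q)} ∈ N ↔ u^1_{(p',q)} ∈ N`** (up-moves cross only live `A`-arrows,
down-moves are free). [cite: Kovacevic2021, §3 proof of Thm 3, Remark 6] -/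
theorem principalSeries_vec_one_mem_iff_of_noRoot_p {p p' q : ℤ} (hp : 0 ≤ p) (hpp' : p ≤ p') (hq : 0 ≤ q)
    (ha : ∀ r : ℤ, p ≤ r → r < p' → acoef c t r ≠ 0) :
    (principalSeries c t).vec (1 + p + q) (2 * t + 3 * p - 3 * q) 1 ∈ N ↔
      (principalSeries c t).vec (1 + p' + q) (2 * t + 3 * p' - 3 * q) 1 ∈ N := by
  obtain ⟨d, rfl⟩ : ∃ d : ℕ, p' = p + d := ⟨(p' - p).toNat, by omega⟩
  exact ⟨fun h => principalSeries_vec_one_mem_up_p N hp hq d h ha,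
    fun h => principalSeries_vec_one_mem_down_p N hp hq d h⟩

/-- **No root of `b` in `[q, q')` ⇒ `u^1_{(p,q)} ∈ N ↔ u^1_{(p,q')} ∈ N`.** [cite: Kovacevic2021, §3 proof of Thm 3, Remark 6] -/
theorem principalSeries_vec_one_mem_iff_of_noRoot_q {p q q' : ℤ} (hp : 0 ≤ p) (hq : 0 ≤ q) (hqq' : q ≤ q')
    (hb : ∀ s : ℤ, q ≤ s → s < q' → bcoef c t s ≠ 0) :
    (principalSeries c t).vec (1 + p + q) (2 * t + 3 * p - 3 * q) 1 ∈ N ↔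
      (principalSeries c t).vec (1 + p + q') (2 * t + 3 * p - 3 * q') 1 ∈ N := by
  obtain ⟨d, rfl⟩ : ∃ d : ℕ, q' = q + d := ⟨(q' - q).toNat, by omega⟩
  exact ⟨fun h => principalSeries_vec_one_mem_up_q N hp hq d h hb,
    fun h => principalSeries_vec_one_mem_down_q N hp hq d h⟩

/-! ## §2 The `K`-type set of a submodule is a lower set, closed across the live arrows -/

/-- **Down-closure in both coordinates**: `u^1_{(p,q)} ∈ N`, `p' ≤ p`, `q' ≤ q` ⇒ `u^1_{(p',q')} ∈ N`.
[cite: Kovacevic2021, §3 Thm 3 (b95), (b100), Remark 6] -/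
theorem principalSeries_vec_one_mem_of_le {p q p' q' : ℤ} (hp' : 0 ≤ p') (hq' : 0 ≤ q') (hpp : p' ≤ p)
    (hqq : q' ≤ q) (h : (principalSeries c t).vec (1 + p + q) (2 * t + 3 * p - 3 * q) 1 ∈ N) :
    (principalSeries c t).vec (1 + p' + q') (2 * t + 3 * p' - 3 * q') 1 ∈ N := by
  obtain ⟨d, rfl⟩ : ∃ d : ℕ, p = p' + d := ⟨(p - p').toNat, by omega⟩
  obtain ⟨e, rfl⟩ : ∃ e : ℕ, q = q' + e := ⟨(q - q').toNat, by omega⟩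
  exact principalSeries_vec_one_mem_down_q N hp' hq' e (principalSeries_vec_one_mem_down_p N hp' (by positivity) d h)

/-- **The `K`-types `(p,q) ∈ ℕ × ℕ` met by a Lie submodule of `V(c,2t)` form a lower set** (for the product order).
[cite: Kovacevic2021, §3 Thm 3 (b95), (b100), Remark 6] -/
theorem principalSeries_isLowerSet :
    IsLowerSet {x : ℕ × ℕ |
      (principalSeries c t).vec (1 + (x.1 : ℤ) + x.2) (2 * t + 3 * (x.1 : ℤ) - 3 * x.2) 1 ∈ N} := by
  rintro ⟨p, q⟩ ⟨p', q'⟩ ⟨hpp, hqq⟩ h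
  exact principalSeries_vec_one_mem_of_le N (by positivity) (by positivity) (by exact_mod_cast hpp)
    (by exact_mod_cast hqq) h

/-- closure one step to the right across a non-root of `a` (`ℕ`-coordinates) [cite: Kovacevic2021, §3 Thm 3 (b85), Remark 6] -/
theorem principalSeries_vec_one_mem_succ_p_nat {p q : ℕ}
    (h : (principalSeries c t).vec (1 + (p : ℤ) + q) (2 * t + 3 * (p : ℤ) - 3 * q) 1 ∈ N) (ha : acoef c t p ≠ 0) :
    (principalSeries c t).vec (1 + ((p + 1 : ℕ) : ℤ) + q) (2 * t + 3 * ((p + 1 : ℕ) : ℤ) - 3 * q) 1 ∈ N := by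
  have := principalSeries_vec_one_mem_succ_p N (by positivity) (by positivity) h ha
  convert this using 2 <;> push_cast <;> ring

/-- closure one step up across a non-root of `b` (`ℕ`-coordinates) [cite: Kovacevic2021, §3 Thm 3 (b90), Remark 6] -/
theorem principalSeries_vec_one_mem_succ_q_nat {p q : ℕ}
    (h : (principalSeries c t).vec (1 + (p : ℤ) + q) (2 * t + 3 * (p : ℤ) - 3 * q) 1 ∈ N) (hb : bcoef c t q ≠ 0) :
    (principalSeries c t).vec (1 + (p : ℤ) + ((q + 1 : ℕ) : ℤ)) (2 * t + 3 * (p : ℤ) - 3 * ((q + 1 : ℕ) : ℤ)) 1 ∈ N := by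
  have := principalSeries_vec_one_mem_succ_q N (by positivity) (by positivity) h hb
  convert this using 2 <;> push_cast <;> ring

/-- **`N ≤ N'` iff every `K`-type `(p,q)` (`p, q ∈ ℕ`) met by `N` is met by `N'`.** [cite: Kovacevic2021, §3 Thm 2, Remark 2] -/
theorem principalSeries_le_iff_forall_nat (N' : LieSubmodule ℂ (Matrix (Fin 3) (Fin 3) ℂ) (principalSeries c t).V) :
    N ≤ N' ↔ ∀ p q : ℕ, (principalSeries c t).vec (1 + (p : ℤ) + q) (2 * t + 3 * (p : ℤ) - 3 * q) 1 ∈ N →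
      (principalSeries c t).vec (1 + (p : ℤ) + q) (2 * t + 3 * (p : ℤ) - 3 * q) 1 ∈ N' := by
  rw [le_iff_forall_vec_one]
  refine ⟨fun h p q => h _ _ (mem_cone (by positivity) (by positivity) rfl rfl), fun h n m hS => ?_⟩
  obtain ⟨p, q, hp, hq, rfl, rfl⟩ := (mem_principalSeries_S_iff c t n m).1 hS
  lift p to ℕ using hp
  lift q to ℕ using hq
  exact h p q

/-- **Two Lie submodules of `V(c,2t)` meeting the same `K`-types `(p,q)` are equal.** [cite: Kovacevic2021, §3 Thm 2, Remark 2] -/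
theorem principalSeries_eq_iff_forall_nat (N' : LieSubmodule ℂ (Matrix (Fin 3) (Fin 3) ℂ) (principalSeries c t).V) :
    N = N' ↔ ∀ p q : ℕ, ((principalSeries c t).vec (1 + (p : ℤ) + q) (2 * t + 3 * (p : ℤ) - 3 * q) 1 ∈ N ↔
      (principalSeries c t).vec (1 + (p : ℤ) + q) (2 * t + 3 * (p : ℤ) - 3 * q) 1 ∈ N') := by
  refine ⟨fun h p q => by rw [h], fun h => le_antisymm ?_ ?_⟩
  · exact (principalSeries_le_iff_forall_nat N N').2 fun p q hv => (h p q).1 hv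
  · exact (principalSeries_le_iff_forall_nat N' N).2 fun p q hv => (h p q).2 hv

end Cells

/-! ## §3 Every admissible set of `K`-types is the `K`-type set of exactly one Lie submodule -/

section Classification

variable (c : ℂ) (t : ℤ)

/-- **Classification of the Lie submodules of `V(c,2t)`.**  For every lower set `R ⊆ ℕ × ℕ` which is closed one
step to the right across every non-root of `a` (`(p,q) ∈ R`, `a(p) ≠ 0 ⇒ (p+1,q) ∈ R`) and one step up across every
non-root of `b`, there is EXACTLY ONE Lie submodule `N ⊆ V(c,2t)` whose `K`-types are `{V_{1+p+q,2t+3p−3q} : (p,q) ∈ R}`;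
with §2 (`principalSeries_isLowerSet`, `…_succ_p_nat`, `…_succ_q_nat`, `principalSeries_le_iff_forall_nat`) the map
`N ↦ R_N` is an isomorphism of the lattice of Lie submodules of `V(c,2t)` onto the lattice of such sets `R`.
[cite: Kovacevic2021, §3 Thm 3 (proof) and Remark 6] -/
theorem principalSeries_existsUnique_lieSubmodule {R : Set (ℕ × ℕ)} (hR : IsLowerSet R)
    (ha : ∀ p q : ℕ, (p, q) ∈ R → acoef c t p ≠ 0 → (p + 1, q) ∈ R)
    (hb : ∀ p q : ℕ, (p, q) ∈ R → bcoef c t q ≠ 0 → (p, q + 1) ∈ R) :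
    ∃! N : LieSubmodule ℂ (Matrix (Fin 3) (Fin 3) ℂ) (principalSeries c t).V,
      ∀ p q : ℕ, (principalSeries c t).vec (1 + (p : ℤ) + q) (2 * t + 3 * (p : ℤ) - 3 * q) 1 ∈ N ↔ (p, q) ∈ R := by
  -- the `(n,m)`-image of `R` is closed under the live arrows of `V(c,2t)`, hence spans a Lie submodule
  have hex : ∃ N : LieSubmodule ℂ (Matrix (Fin 3) (Fin 3) ℂ) (principalSeries c t).V,
      (N : Submodule ℂ (principalSeries c t).V) = Finsupp.supported ℂ ℂ
        {x : (principalSeries c t).Idx | (x.1.1, x.1.2.1) ∈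
          {y : ℤ × ℤ | ∃ p q : ℕ, (p, q) ∈ R ∧ y = (1 + (p : ℤ) + q, 2 * t + 3 * (p : ℤ) - 3 * q)}} := by
    refine exists_lieSubmodule_eq_supported ?_ ?_ ?_ ?_
    · rintro n m ⟨p, q, hpq, ⟨rfl, rfl⟩⟩ hA -
      have ha' : acoef c t p ≠ 0 := (principalSeries_A_ne_zero_iff c t (by positivity) (by positivity)).1 hA
      exact ⟨p + 1, q, ha p q hpq ha', Prod.ext (by push_cast; ring) (by push_cast; ring)⟩
    · rintro n m ⟨p, q, hpq, ⟨rfl, rfl⟩⟩ hB -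
      have hb' : bcoef c t q ≠ 0 := (principalSeries_B_ne_zero_iff c t (by positivity) (by positivity)).1 hB
      exact ⟨p, q + 1, hb p q hpq hb', Prod.ext (by push_cast; ring) (by push_cast; ring)⟩
    · rintro n m ⟨p, q, hpq, ⟨rfl, rfl⟩⟩ hC -
      have hq0 : (q : ℤ) ≠ 0 := (principalSeries_C_ne_zero_iff c t (by positivity) (by positivity)).1 hC
      obtain ⟨q₁, rfl⟩ : ∃ q₁ : ℕ, q = q₁ + 1 := Nat.exists_eq_add_one_of_ne_zero (by exact_mod_cast hq0)
      exact ⟨p, q₁, hR (show ((p, q₁) : ℕ × ℕ) ≤ (p, q₁ + 1) from ⟨le_rfl, Nat.le_succ _⟩) hpq,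
        Prod.ext (by push_cast; ring) (by push_cast; ring)⟩
    · rintro n m ⟨p, q, hpq, ⟨rfl, rfl⟩⟩ hD -
      have hp0 : (p : ℤ) ≠ 0 := (principalSeries_D_ne_zero_iff c t (by positivity) (by positivity)).1 hD
      obtain ⟨p₁, rfl⟩ : ∃ p₁ : ℕ, p = p₁ + 1 := Nat.exists_eq_add_one_of_ne_zero (by exact_mod_cast hp0)
      exact ⟨p₁, q, hR (show ((p₁, q) : ℕ × ℕ) ≤ (p₁ + 1, q) from ⟨Nat.le_succ _, le_rfl⟩) hpq,
        Prod.ext (by push_cast; ring) (by push_cast; ring)⟩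
  obtain ⟨N, hN⟩ := hex
  -- read off the `K`-types of `N`
  have key : ∀ p q : ℕ, (principalSeries c t).vec (1 + (p : ℤ) + q) (2 * t + 3 * (p : ℤ) - 3 * q) 1 ∈ N ↔
      (p, q) ∈ R := by
    intro p q
    rw [← LieSubmodule.mem_toSubmodule, hN,
      vec_mem_supported_iff ⟨mem_cone (by positivity) (by positivity) rfl rfl, le_rfl, by omega⟩]
    refine ⟨?_, fun h => ⟨p, q, h, rfl⟩⟩
    rintro ⟨p', q', hR', hy⟩
    obtain ⟨hpp, hqq⟩ := coords_unique (Prod.mk.inj hy).1 (Prod.mk.inj hy).2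
    obtain rfl : p = p' := by exact_mod_cast hpp
    obtain rfl : q = q' := by exact_mod_cast hqq
    exact hR'
  exact ⟨N, key, fun N' hN' => (principalSeries_eq_iff_forall_nat N' N).2 fun p q =>
    (hN' p q).trans (key p q).symm⟩

/-! ## §4 Finiteness of the submodule lattice -/

/-- **`a(p) = 2c − (p+1)t − p(p+2)` has finitely many roots `p ∈ ℕ`** (it is the value at `p` of the non-zero
polynomial `(2c−t) − (t+2)X − X²`). [cite: Kovacevic2021, §3 Thm 3 (b85), §4] -/
theorem acoef_natRoots_finite : {p : ℕ | acoef c t p = 0}.Finite := by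
  set P : Polynomial ℂ := Polynomial.C (2 * c - t) - Polynomial.C ((t : ℂ) + 2) * Polynomial.X -
    Polynomial.X ^ 2 with hP
  have hP0 : P ≠ 0 := by
    intro h
    have h2 := congrArg (fun f : Polynomial ℂ => f.coeff 2) h
    simp only [hP, Polynomial.coeff_sub, Polynomial.coeff_C_mul, Polynomial.coeff_C, Polynomial.coeff_X,
      Polynomial.coeff_X_pow, Polynomial.coeff_zero] at h2
    norm_num at h2
  refine ((Polynomial.finite_setOf_isRoot hP0).preimage fun _ _ _ _ h => Nat.cast_injective h).subset
    fun p hp => ?_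
  have hev : P.eval (p : ℂ) = acoef c t p := by
    simp only [hP, acoef, Polynomial.eval_sub, Polynomial.eval_C, Polynomial.eval_mul, Polynomial.eval_X,
      Polynomial.eval_pow]
    push_cast
    ring
  simp only [Set.mem_preimage, Set.mem_setOf_eq, Polynomial.IsRoot.def, hev]
  exact hp

/-- **`b(q) = 2c + (q+1)t − q(q+2)` has finitely many roots `q ∈ ℕ`.** [cite: Kovacevic2021, §3 Thm 3 (b90), §4] -/
theorem bcoef_natRoots_finite : {q : ℕ | bcoef c t q = 0}.Finite := by
  set P : Polynomial ℂ := Polynomial.C (2 * c + t) + Polynomial.C ((t : ℂ) - 2) * Polynomial.X -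
    Polynomial.X ^ 2 with hP
  have hP0 : P ≠ 0 := by
    intro h
    have h2 := congrArg (fun f : Polynomial ℂ => f.coeff 2) h
    simp only [hP, Polynomial.coeff_sub, Polynomial.coeff_add, Polynomial.coeff_C_mul, Polynomial.coeff_C,
      Polynomial.coeff_X, Polynomial.coeff_X_pow, Polynomial.coeff_zero] at h2
    norm_num at h2
  refine ((Polynomial.finite_setOf_isRoot hP0).preimage fun _ _ _ _ h => Nat.cast_injective h).subset
    fun q hq => ?_
  have hev : P.eval (q : ℂ) = bcoef c t q := by
    simp only [hP, bcoef, Polynomial.eval_sub, Polynomial.eval_add, Polynomial.eval_C, Polynomial.eval_mul,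
      Polynomial.eval_X, Polynomial.eval_pow]
    push_cast
    ring
  simp only [Set.mem_preimage, Set.mem_setOf_eq, Polynomial.IsRoot.def, hev]
  exact hq

/-- **A root-free bound**: some `B ∈ ℕ` exceeds every natural root of `a` and of `b`; beyond it all arrows are live.
[cite: Kovacevic2021, §3 Thm 3, Remark 6] -/
theorem principalSeries_exists_rootFree_bound :
    ∃ B : ℕ, (∀ p : ℕ, acoef c t p = 0 → p < B) ∧ (∀ q : ℕ, bcoef c t q = 0 → q < B) := by
  obtain ⟨Ba, hBa⟩ := (acoef_natRoots_finite c t).bddAbove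
  obtain ⟨Bb, hBb⟩ := (bcoef_natRoots_finite c t).bddAbove
  refine ⟨max Ba Bb + 1, fun p hp => ?_, fun q hq => ?_⟩
  · have := hBa hp
    omega
  · have := hBb hq
    omega

variable {c t} in
/-- beyond a root-free bound `B`, membership of `u^1_{(p,q)}` only depends on `(min p B, min q B)`
[cite: Kovacevic2021, §3 proof of Thm 3, Remark 6] -/
private theorem vec_one_mem_iff_min (N : LieSubmodule ℂ (Matrix (Fin 3) (Fin 3) ℂ) (principalSeries c t).V)
    {B : ℕ} (hBa : ∀ p : ℕ, acoef c t p = 0 → p < B) (hBb : ∀ q : ℕ, bcoef c t q = 0 → q < B) (p q : ℕ) :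
    (principalSeries c t).vec (1 + (p : ℤ) + q) (2 * t + 3 * (p : ℤ) - 3 * q) 1 ∈ N ↔
      (principalSeries c t).vec (1 + ((min p B : ℕ) : ℤ) + ((min q B : ℕ) : ℤ))
        (2 * t + 3 * ((min p B : ℕ) : ℤ) - 3 * ((min q B : ℕ) : ℤ)) 1 ∈ N := by
  -- no root of `a` lies in `[min p B, p)`, none of `b` in `[min q B, q)`
  have hpa : ∀ r : ℤ, ((min p B : ℕ) : ℤ) ≤ r → r < p → acoef c t r ≠ 0 := by
    intro r hr hrp h0
    obtain ⟨r', rfl⟩ := Int.eq_ofNat_of_zero_le (by omega : 0 ≤ r)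
    have h1 := hBa r' h0
    rcases le_total p B with h | h
    · rw [min_eq_left h] at hr
      omega
    · rw [min_eq_right h] at hr
      omega
  have hqb : ∀ s : ℤ, ((min q B : ℕ) : ℤ) ≤ s → s < q → bcoef c t s ≠ 0 := by
    intro s hs hsq h0
    obtain ⟨s', rfl⟩ := Int.eq_ofNat_of_zero_le (by omega : 0 ≤ s)
    have h1 := hBb s' h0
    rcases le_total q B with h | h
    · rw [min_eq_left h] at hs
      omega
    · rw [min_eq_right h] at hs
      omega
  rw [← principalSeries_vec_one_mem_iff_of_noRoot_p N (by positivity) (by exact_mod_cast min_le_left p B)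
      (by positivity) hpa,
    ← principalSeries_vec_one_mem_iff_of_noRoot_q N (by positivity) (by positivity)
      (by exact_mod_cast min_le_left q B) hqb]

/-- **`V(c,2t)` has only finitely many Lie submodules** (a submodule is determined by the `K`-types `(p,q)`,
`p, q ≤ B`, that it meets, `B` a root-free bound); in particular `V(c,2t)` has finite length.
[cite: Kovacevic2021, §3 Thm 3 and Remark 6] -/
theorem principalSeries_lieSubmodule_finite :
    Finite (LieSubmodule ℂ (Matrix (Fin 3) (Fin 3) ℂ) (principalSeries c t).V) := by
  obtain ⟨B, hBa, hBb⟩ := principalSeries_exists_rootFree_bound c t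
  refine Finite.of_injective
    (fun N : LieSubmodule ℂ (Matrix (Fin 3) (Fin 3) ℂ) (principalSeries c t).V =>
      {x : Fin (B + 1) × Fin (B + 1) |
        (principalSeries c t).vec (1 + ((x.1 : ℕ) : ℤ) + ((x.2 : ℕ) : ℤ))
          (2 * t + 3 * ((x.1 : ℕ) : ℤ) - 3 * ((x.2 : ℕ) : ℤ)) 1 ∈ N})
    fun N N' h => ?_
  have key : ∀ p q : ℕ, p ≤ B → q ≤ B →
      ((principalSeries c t).vec (1 + (p : ℤ) + q) (2 * t + 3 * (p : ℤ) - 3 * q) 1 ∈ N ↔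
        (principalSeries c t).vec (1 + (p : ℤ) + q) (2 * t + 3 * (p : ℤ) - 3 * q) 1 ∈ N') := by
    intro p q hp hq
    have := congrArg
      (fun s : Set (Fin (B + 1) × Fin (B + 1)) => ((⟨p, Nat.lt_succ_of_le hp⟩, ⟨q, Nat.lt_succ_of_le hq⟩) :
        Fin (B + 1) × Fin (B + 1)) ∈ s) h
    exact Iff.of_eq this
  refine (principalSeries_eq_iff_forall_nat N N').2 fun p q => ?_
  rw [vec_one_mem_iff_min N hBa hBb, vec_one_mem_iff_min N' hBa hBb]
  exact key _ _ (min_le_right p B) (min_le_right q B)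

end Classification

end SU21Datum

end Literature.RepresentationTheory.Kovacevic2021
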